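import Literature.NumberTheory.LFunctions.QuadraticCharacterShiftSumsLocal
import HarnessLib

/-!
# Complete shifted sums of quadratic characters: the moduli `4` and `8`

Topic `Literature/NumberTheory/LFunctions`. Everything in this file is PROVED (theorems only).
The `2`-part of the level of a primitive quadratic character is `1`, `4` or `8`
(`Literature.NumberTheory.LFunctions.eq_two_or_three_of_isPrimitive_two_pow`); here we record
the value tables of the primitive quadratic characters mod `4` and mod `8` (`χ(3) = −1` mod `4`;
`χ(5) = −1`, `χ(7) = −χ(3)` mod `8` — Montgomery–Vaughan §9.3) and evaluate, for EVEN shifts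
`t`, the three complete sums of Matomäki–Merikoski's Lemma 2.5 at these moduli
("for `r ∈ {2, 3}` and even `h`": `∑ χ₀(m)χ₀(±m+h) = φ(2^r)`, `∑ χ(m)χ₀(±m+h) = 0`,
`∑ χ(m)χ(±m+h) = χ(±1) φ(2^r) 1_{φ(2^r) ∣ h} (−1)^{h/φ(2^r)}`; the `−` sign is reduced to `+` by
`Literature.NumberTheory.LFunctions.shiftSum_neg`). The computations are finite and are carried
out by enumeration of `ℤ/4` and `ℤ/8`.

## References

* K. Matomäki, J. Merikoski, *Siegel zeros, twin primes, Goldbach's conjecture, and primes in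
  short intervals*, IMRN 2023 (arXiv:2112.11412), proof of Lemma 2.5 in §3.4 (the case
  `q = 2^r`, `r ∈ {2, 3}`). [cite: MatomakiMerikoski2023, §3.4]
* H. L. Montgomery, R. C. Vaughan, *Multiplicative Number Theory I*, CUP 2007, §9.3 (the
  primitive quadratic characters mod `4` and `8`). [cite: MontgomeryVaughan2007, §9.3]
-/

noncomputable section

open DirichletCharacter Finset

namespace Literature.NumberTheory.LFunctions

/-! ### Modulus `4` -/

section four

/-- The units of `ℤ/4` are `1` and `3`. [folklore] -/
theorem isUnit_zmod_four_iff : ∀ x : ZMod 4, IsUnit x ↔ (x = 1 ∨ x = 3) := by decide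

/-- `∑_{m mod 4} f(m) = f(0) + f(1) + f(2) + f(3)`. [folklore] -/
theorem sum_zmod_four (f : ZMod 4 → ℂ) : ∑ m : ZMod 4, f m = f 0 + f 1 + f 2 + f 3 :=
  Fin.sum_univ_four f

/-- `∑_{m mod 4} f(m) g(m + 2)` written out. [folklore] -/
theorem sum_mul_shift_two_zmod_four (f g : ZMod 4 → ℂ) :
    ∑ m : ZMod 4, f m * g (m + 2) = f 0 * g 2 + f 1 * g 3 + f 2 * g 0 + f 3 * g 1 := by
  have h : (0 : ZMod 4) + 2 = 2 ∧ (1 : ZMod 4) + 2 = 3 ∧ (2 : ZMod 4) + 2 = 0 ∧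
      (3 : ZMod 4) + 2 = 1 := by decide
  rw [sum_zmod_four, h.1, h.2.1, h.2.2.1, h.2.2.2]

variable (χ : DirichletCharacter ℂ 4)

/-- **The primitive quadratic character mod `4` has `χ(3) = −1`** ("the primitive character
`χ` given by `χ(4k+1) = 1`, `χ(4k−1) = −1`"). [cite: MontgomeryVaughan2007, §9.3] -/
theorem apply_three_eq_neg_one_of_isPrimitive (hprim : χ.IsPrimitive) (hquad : χ.IsQuadratic) :
    χ 3 = -1 := by
  have h3 : IsUnit (3 : ZMod 4) := (isUnit_zmod_four_iff 3).mpr (Or.inr rfl)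
  rcases hquad 3 with h0 | h1 | hm1
  · exact absurd h0 (h3.map χ).ne_zero
  · exfalso
    have hχ1 : χ = 1 := by
      refine MulChar.ext fun u => ?_
      rw [MulChar.one_apply_coe]
      rcases (isUnit_zmod_four_iff u).mp u.isUnit with hu | hu
      · rw [show χ u = χ (u : ZMod 4) from rfl, hu, map_one]
      · rw [show χ u = χ (u : ZMod 4) from rfl, hu, h1]
    have := hprim
    rw [isPrimitive_def, hχ1, conductor_one] at this
    exact absurd this (by norm_num)
  · exact hm1

/-- Value table of the primitive quadratic character mod `4`: `χ(0) = χ(2) = 0`, `χ(1) = 1`,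
`χ(3) = −1`. [cite: MontgomeryVaughan2007, §9.3] -/
theorem values_four (hprim : χ.IsPrimitive) (hquad : χ.IsQuadratic) :
    χ 0 = 0 ∧ χ 1 = 1 ∧ χ 2 = 0 ∧ χ 3 = -1 := by
  refine ⟨?_, map_one χ, ?_, apply_three_eq_neg_one_of_isPrimitive χ hprim hquad⟩
  · exact χ.map_nonunit (fun h => by have := (isUnit_zmod_four_iff 0).mp h; revert this; decide)
  · exact χ.map_nonunit (fun h => by have := (isUnit_zmod_four_iff 2).mp h; revert this; decide)

/-- Value table of the principal character mod `4`. [folklore] -/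
theorem values_one_four : (1 : DirichletCharacter ℂ 4) 0 = 0 ∧ (1 : DirichletCharacter ℂ 4) 1 = 1 ∧
    (1 : DirichletCharacter ℂ 4) 2 = 0 ∧ (1 : DirichletCharacter ℂ 4) 3 = 1 := by
  refine ⟨?_, map_one 1, ?_, ?_⟩
  · exact MulChar.map_nonunit _
      (fun h => by have := (isUnit_zmod_four_iff 0).mp h; revert this; decide)
  · exact MulChar.map_nonunit _
      (fun h => by have := (isUnit_zmod_four_iff 2).mp h; revert this; decide)
  · exact MulChar.one_apply ((isUnit_zmod_four_iff 3).mpr (Or.inr rfl))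

/-- **MM Lemma 2.5 (3) at the modulus `4`, even shift**: `∑_{m mod 4} χ(m)χ(m + t) = 2` for
`t ≡ 0` and `= −2` for `t ≡ 2 (mod 4)`, i.e. `φ(4) 1_{2 ∣ t} (−1)^{t/2}`.
[cite: MatomakiMerikoski2023, §3.4] -/
theorem shiftSum_quad_quad_four (hprim : χ.IsPrimitive) (hquad : χ.IsQuadratic) {t : ZMod 4}
    (ht : t = 0 ∨ t = 2) : shiftSum χ χ 1 t = if t = 0 then 2 else -2 := by
  obtain ⟨h0, h1, h2, h3⟩ := values_four χ hprim hquad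
  rcases ht with rfl | rfl
  · rw [if_pos rfl, shiftSum_def, sum_zmod_four]
    norm_num [h0, h1, h2, h3]
  · rw [if_neg (by decide), shiftSum_def]
    simp only [one_mul, sum_mul_shift_two_zmod_four, h0, h1, h2, h3]
    norm_num

/-- **MM Lemma 2.5 (2) at the modulus `4`, even shift**: `∑_{m mod 4} χ(m)χ₀(m + t) = 0`.
[cite: MatomakiMerikoski2023, §3.4] -/
theorem shiftSum_quad_one_four (hprim : χ.IsPrimitive) (hquad : χ.IsQuadratic) {t : ZMod 4}
    (ht : t = 0 ∨ t = 2) : shiftSum χ 1 1 t = 0 := by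
  obtain ⟨h0, h1, h2, h3⟩ := values_four χ hprim hquad
  obtain ⟨g0, g1, g2, g3⟩ := values_one_four
  rcases ht with rfl | rfl
  · rw [shiftSum_def, sum_zmod_four]
    norm_num [h0, h1, h2, h3, g0, g1, g2, g3]
  · rw [shiftSum_def]
    simp only [one_mul, sum_mul_shift_two_zmod_four, h0, h1, h2, h3, g0, g1, g2, g3]
    norm_num

/-- **MM Lemma 2.5 (1) at the modulus `4`, even shift**: `∑_{m mod 4} χ₀(m)χ₀(m + t) = 2 = φ(4)`.
[cite: MatomakiMerikoski2023, §3.4] -/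
theorem shiftSum_one_one_four {t : ZMod 4} (ht : t = 0 ∨ t = 2) :
    shiftSum (1 : DirichletCharacter ℂ 4) 1 1 t = 2 := by
  obtain ⟨g0, g1, g2, g3⟩ := values_one_four
  rcases ht with rfl | rfl
  · rw [shiftSum_def, sum_zmod_four]
    norm_num [g0, g1, g2, g3]
  · rw [shiftSum_def]
    simp only [one_mul, sum_mul_shift_two_zmod_four, g0, g1, g2, g3]
    norm_num

end four

/-! ### Modulus `8` -/

section eight

/-- The units of `ℤ/8` are `1, 3, 5, 7`. [folklore] -/
theorem isUnit_zmod_eight_iff : ∀ x : ZMod 8, IsUnit x ↔ (x = 1 ∨ x = 3 ∨ x = 5 ∨ x = 7) := by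
  decide

/-- The kernel of `(ℤ/8)ˣ → (ℤ/4)ˣ` is `{1, 5}`. [folklore] -/
theorem cast_four_eq_one_iff : ∀ x : ZMod 8, IsUnit x → ((ZMod.cast x : ZMod 4) = 1 ↔
    (x = 1 ∨ x = 5)) := by
  decide

/-- `∑_{m mod 8} f(m) = f(0) + ⋯ + f(7)`. [folklore] -/
theorem sum_zmod_eight (f : ZMod 8 → ℂ) :
    ∑ m : ZMod 8, f m = f 0 + f 1 + f 2 + f 3 + f 4 + f 5 + f 6 + f 7 :=
  Fin.sum_univ_eight f

/-- `∑_{m mod 8} f(m) g(m + 2)` written out. [folklore] -/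
theorem sum_mul_shift_two_zmod_eight (f g : ZMod 8 → ℂ) :
    ∑ m : ZMod 8, f m * g (m + 2) = f 0 * g 2 + f 1 * g 3 + f 2 * g 4 + f 3 * g 5 + f 4 * g 6 +
      f 5 * g 7 + f 6 * g 0 + f 7 * g 1 := by
  have h : (0 : ZMod 8) + 2 = 2 ∧ (1 : ZMod 8) + 2 = 3 ∧ (2 : ZMod 8) + 2 = 4 ∧
      (3 : ZMod 8) + 2 = 5 ∧ (4 : ZMod 8) + 2 = 6 ∧ (5 : ZMod 8) + 2 = 7 ∧ (6 : ZMod 8) + 2 = 0 ∧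
      (7 : ZMod 8) + 2 = 1 := by decide
  obtain ⟨e0, e1, e2, e3, e4, e5, e6, e7⟩ := h
  rw [sum_zmod_eight, e0, e1, e2, e3, e4, e5, e6, e7]

/-- `∑_{m mod 8} f(m) g(m + 4)` written out. [folklore] -/
theorem sum_mul_shift_four_zmod_eight (f g : ZMod 8 → ℂ) :
    ∑ m : ZMod 8, f m * g (m + 4) = f 0 * g 4 + f 1 * g 5 + f 2 * g 6 + f 3 * g 7 + f 4 * g 0 +
      f 5 * g 1 + f 6 * g 2 + f 7 * g 3 := by
  have h : (0 : ZMod 8) + 4 = 4 ∧ (1 : ZMod 8) + 4 = 5 ∧ (2 : ZMod 8) + 4 = 6 ∧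
      (3 : ZMod 8) + 4 = 7 ∧ (4 : ZMod 8) + 4 = 0 ∧ (5 : ZMod 8) + 4 = 1 ∧ (6 : ZMod 8) + 4 = 2 ∧
      (7 : ZMod 8) + 4 = 3 := by decide
  obtain ⟨e0, e1, e2, e3, e4, e5, e6, e7⟩ := h
  rw [sum_zmod_eight, e0, e1, e2, e3, e4, e5, e6, e7]

/-- `∑_{m mod 8} f(m) g(m + 6)` written out. [folklore] -/
theorem sum_mul_shift_six_zmod_eight (f g : ZMod 8 → ℂ) :
    ∑ m : ZMod 8, f m * g (m + 6) = f 0 * g 6 + f 1 * g 7 + f 2 * g 0 + f 3 * g 1 + f 4 * g 2 +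
      f 5 * g 3 + f 6 * g 4 + f 7 * g 5 := by
  have h : (0 : ZMod 8) + 6 = 6 ∧ (1 : ZMod 8) + 6 = 7 ∧ (2 : ZMod 8) + 6 = 0 ∧
      (3 : ZMod 8) + 6 = 1 ∧ (4 : ZMod 8) + 6 = 2 ∧ (5 : ZMod 8) + 6 = 3 ∧ (6 : ZMod 8) + 6 = 4 ∧
      (7 : ZMod 8) + 6 = 5 := by decide
  obtain ⟨e0, e1, e2, e3, e4, e5, e6, e7⟩ := h
  rw [sum_zmod_eight, e0, e1, e2, e3, e4, e5, e6, e7]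

variable (χ : DirichletCharacter ℂ 8)

/-- **A primitive character mod `8` has `χ(5) = −1`**: otherwise `χ` is trivial on the kernel
`{1, 5}` of `(ℤ/8)ˣ → (ℤ/4)ˣ` and factors through `4` ("the character is primitive if and only
if `k` is odd", `χ((−1)^μ 5^ν) = e(jμ/2 + kν/2)`). [cite: MontgomeryVaughan2007, §9.3] -/
theorem apply_five_eq_neg_one_of_isPrimitive (hprim : χ.IsPrimitive) (hquad : χ.IsQuadratic) :
    χ 5 = -1 := by
  have h5 : IsUnit (5 : ZMod 8) := (isUnit_zmod_eight_iff 5).mpr (Or.inr (Or.inr (Or.inl rfl)))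
  rcases hquad 5 with h0 | h1 | hm1
  · exact absurd h0 (h5.map χ).ne_zero
  · exfalso
    have hfac : χ.FactorsThrough 4 := by
      rw [factorsThrough_iff_ker_unitsMap (by norm_num : 4 ∣ 8)]
      intro u hu
      rw [MonoidHom.mem_ker, Units.ext_iff, ZMod.unitsMap_def, Units.coe_map, MonoidHom.coe_coe,
        ZMod.castHom_apply, Units.val_one] at hu
      rw [MonoidHom.mem_ker, Units.ext_iff, MulChar.coe_toUnitHom, Units.val_one]
      rcases (cast_four_eq_one_iff u u.isUnit).mp hu with hu1 | hu5
      · rw [show χ u = χ (u : ZMod 8) from rfl, hu1, map_one]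
      · rw [show χ u = χ (u : ZMod 8) from rfl, hu5, h1]
    exact Literature.Barriers.Parity.SiegelCorr.not_isPrimitive_of_factorsThrough χ (by norm_num)
      (by norm_num) hfac hprim
  · exact hm1

/-- Value table of a primitive quadratic character mod `8`: `χ` vanishes at even residues,
`χ(1) = 1`, `χ(5) = −1`, `χ(7) = −χ(3)` and `χ(3) = ±1` (the two characters `χ₂`, `χ₁χ₂` of
Montgomery–Vaughan §9.3). [cite: MontgomeryVaughan2007, §9.3] -/
theorem values_eight (hprim : χ.IsPrimitive) (hquad : χ.IsQuadratic) :
    χ 0 = 0 ∧ χ 1 = 1 ∧ χ 2 = 0 ∧ χ 4 = 0 ∧ χ 5 = -1 ∧ χ 6 = 0 ∧ χ 7 = -χ 3 ∧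
      (χ 3 = 1 ∨ χ 3 = -1) := by
  have h5 := apply_five_eq_neg_one_of_isPrimitive χ hprim hquad
  have hnu : ∀ x : ZMod 8, (x = 0 ∨ x = 2 ∨ x = 4 ∨ x = 6) → χ x = 0 := by
    intro x hx
    exact χ.map_nonunit (fun h => by
      have := (isUnit_zmod_eight_iff x).mp h
      rcases hx with rfl | rfl | rfl | rfl <;> revert this <;> decide)
  refine ⟨hnu 0 (Or.inl rfl), map_one χ, hnu 2 (Or.inr (Or.inl rfl)),
    hnu 4 (Or.inr (Or.inr (Or.inl rfl))), h5, hnu 6 (Or.inr (Or.inr (Or.inr rfl))), ?_, ?_⟩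
  · rw [show (7 : ZMod 8) = 3 * 5 by decide, map_mul, h5, mul_neg_one]
  · have h3 : IsUnit (3 : ZMod 8) := (isUnit_zmod_eight_iff 3).mpr (Or.inr (Or.inl rfl))
    rcases hquad 3 with h0 | h1 | hm1
    · exact absurd h0 (h3.map χ).ne_zero
    · exact Or.inl h1
    · exact Or.inr hm1

/-- Value table of the principal character mod `8`. [folklore] -/
theorem values_one_eight :
    (1 : DirichletCharacter ℂ 8) 0 = 0 ∧ (1 : DirichletCharacter ℂ 8) 1 = 1 ∧
    (1 : DirichletCharacter ℂ 8) 2 = 0 ∧ (1 : DirichletCharacter ℂ 8) 3 = 1 ∧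
    (1 : DirichletCharacter ℂ 8) 4 = 0 ∧ (1 : DirichletCharacter ℂ 8) 5 = 1 ∧
    (1 : DirichletCharacter ℂ 8) 6 = 0 ∧ (1 : DirichletCharacter ℂ 8) 7 = 1 := by
  have hu : ∀ x : ZMod 8, (x = 1 ∨ x = 3 ∨ x = 5 ∨ x = 7) → (1 : DirichletCharacter ℂ 8) x = 1 :=
    fun x hx => MulChar.one_apply ((isUnit_zmod_eight_iff x).mpr hx)
  have hnu : ∀ x : ZMod 8, (x = 0 ∨ x = 2 ∨ x = 4 ∨ x = 6) →
      (1 : DirichletCharacter ℂ 8) x = 0 := by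
    intro x hx
    exact MulChar.map_nonunit _ (fun h => by
      have := (isUnit_zmod_eight_iff x).mp h
      rcases hx with rfl | rfl | rfl | rfl <;> revert this <;> decide)
  exact ⟨hnu 0 (by decide), hu 1 (by decide), hnu 2 (by decide), hu 3 (by decide),
    hnu 4 (by decide), hu 5 (by decide), hnu 6 (by decide), hu 7 (by decide)⟩

/-- **MM Lemma 2.5 (3) at the modulus `8`, even shift**: `∑_{m mod 8} χ(m)χ(m + t) = 4, 0, −4, 0`
for `t ≡ 0, 2, 4, 6 (mod 8)`, i.e. `φ(8) 1_{4 ∣ t} (−1)^{t/4}`.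
[cite: MatomakiMerikoski2023, §3.4] -/
theorem shiftSum_quad_quad_eight (hprim : χ.IsPrimitive) (hquad : χ.IsQuadratic) {t : ZMod 8}
    (ht : t = 0 ∨ t = 2 ∨ t = 4 ∨ t = 6) :
    shiftSum χ χ 1 t = if t = 0 then 4 else if t = 4 then -4 else 0 := by
  obtain ⟨h0, h1, h2, h4, h5, h6, h7, h3⟩ := values_eight χ hprim hquad
  rcases ht with rfl | rfl | rfl | rfl
  · rw [if_pos rfl, shiftSum_def, sum_zmod_eight]
    norm_num [h0, h1, h2, h4, h5, h6, h7]
    rcases h3 with h | h <;> rw [h] <;> norm_num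
  · rw [if_neg (by decide), if_neg (by decide), shiftSum_def]
    simp only [one_mul, sum_mul_shift_two_zmod_eight, h0, h1, h2, h4, h5, h6, h7]
    ring
  · rw [if_neg (by decide), if_pos rfl, shiftSum_def]
    simp only [one_mul, sum_mul_shift_four_zmod_eight, h0, h1, h2, h4, h5, h6, h7]
    rcases h3 with h | h <;> rw [h] <;> norm_num
  · rw [if_neg (by decide), if_neg (by decide), shiftSum_def]
    simp only [one_mul, sum_mul_shift_six_zmod_eight, h0, h1, h2, h4, h5, h6, h7]
    ring

/-- **MM Lemma 2.5 (2) at the modulus `8`, even shift**: `∑_{m mod 8} χ(m)χ₀(m + t) = 0`.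
[cite: MatomakiMerikoski2023, §3.4] -/
theorem shiftSum_quad_one_eight (hprim : χ.IsPrimitive) (hquad : χ.IsQuadratic) {t : ZMod 8}
    (ht : t = 0 ∨ t = 2 ∨ t = 4 ∨ t = 6) : shiftSum χ 1 1 t = 0 := by
  obtain ⟨h0, h1, h2, h4, h5, h6, h7, h3⟩ := values_eight χ hprim hquad
  obtain ⟨g0, g1, g2, g3, g4, g5, g6, g7⟩ := values_one_eight
  rcases ht with rfl | rfl | rfl | rfl
  · rw [shiftSum_def, sum_zmod_eight]
    norm_num [h0, h1, h2, h4, h5, h6, h7, g0, g1, g2, g3, g4, g5, g6, g7]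
  · rw [shiftSum_def]
    simp only [one_mul, sum_mul_shift_two_zmod_eight, h0, h1, h2, h4, h5, h6, h7, g0, g1, g2, g3,
      g4, g5, g6, g7]
    ring
  · rw [shiftSum_def]
    simp only [one_mul, sum_mul_shift_four_zmod_eight, h0, h1, h2, h4, h5, h6, h7, g0, g1, g2, g3,
      g4, g5, g6, g7]
    ring
  · rw [shiftSum_def]
    simp only [one_mul, sum_mul_shift_six_zmod_eight, h0, h1, h2, h4, h5, h6, h7, g0, g1, g2, g3,
      g4, g5, g6, g7]
    ring

/-- **MM Lemma 2.5 (1) at the modulus `8`, even shift**: `∑_{m mod 8} χ₀(m)χ₀(m + t) = 4 = φ(8)`.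
[cite: MatomakiMerikoski2023, §3.4] -/
theorem shiftSum_one_one_eight {t : ZMod 8} (ht : t = 0 ∨ t = 2 ∨ t = 4 ∨ t = 6) :
    shiftSum (1 : DirichletCharacter ℂ 8) 1 1 t = 4 := by
  obtain ⟨g0, g1, g2, g3, g4, g5, g6, g7⟩ := values_one_eight
  rcases ht with rfl | rfl | rfl | rfl
  · rw [shiftSum_def, sum_zmod_eight]
    norm_num [g0, g1, g2, g3, g4, g5, g6, g7]
  · rw [shiftSum_def]
    simp only [one_mul, sum_mul_shift_two_zmod_eight, g0, g1, g2, g3, g4, g5, g6, g7]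
    norm_num
  · rw [shiftSum_def]
    simp only [one_mul, sum_mul_shift_four_zmod_eight, g0, g1, g2, g3, g4, g5, g6, g7]
    norm_num
  · rw [shiftSum_def]
    simp only [one_mul, sum_mul_shift_six_zmod_eight, g0, g1, g2, g3, g4, g5, g6, g7]
    norm_num

end eight

end Literature.NumberTheory.LFunctions
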